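import Literature.MathematicalPhysics.QuantumFieldTheory.Balaban1983to89.B8SectEInLambdaWitness
import Literature.MathematicalPhysics.QuantumFieldTheory.Balaban1983to89.B8Restr129Inversion
import Literature.MathematicalPhysics.QuantumFieldTheory.Balaban1983to89.B7Prop10InLambda

/-!
# `Balaban1983to89.B8Restr129InversionLocal` — [Balaban1985RegularSpaces] (1.29) p. 81 / (1.78)–(1.79) p. 90 and [Balaban1985Averaging]
# Prop. 10 (203)/(204) p. 50, (166)–(167) p. 44: THE INVERSION ROUTE (a″) OF THE THEOREM-4 KNIT WITH TOWER-LOCAL HYPOTHESES ONLY —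
# inversion of the averages `\overline{R₀u}ʲ` at the tower sites from a `Λ_j`-witness, (1.29) for `u₁⁻¹`, (203)/(204) for any `u₁` with a
# witness, a witness for the product `e^{λ}u₁`, and the driver's clause «(1.29) for `u₁·(e^{λ})⁻¹`» from «`Q′(u₁⁻¹, λ) = 0` on `𝔅_k`»
# with NO global hypothesis and NO binder at `u₁⁻¹`

statement-level skeleton of published theorems with citation tags; proofs where landed; nothing here is a claim about the Yang–Mills mass gap

T. Bałaban, *Spaces of regular gauge field configurations on a lattice and gauge fixing conditions*, Commun. Math. Phys. **99** (1985)
75–102 `[Balaban1985RegularSpaces]` ("B8"; printed page = PDF page + 74), (1.29) p. 81, (1.73)–(1.74) p. 89, (1.78)–(1.79) p. 90, p. 94;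
[3] = `[Balaban1985Averaging]`, (79)–(80) p. 30, (166)–(167) p. 44, (176)–(179) p. 45, Prop. 10 (203)–(206) pp. 49–50.
PDF held: `paper:balaban1985-cmp99-regular-spaces-gauge-fixing`.  STATUS: published, refereed.

CITATION HEADER (lean-in-tree rule).  Cell `pub-ymgap` (YM Track A, DAG node N05 = [B8], HUMAN RULING D-0062), seat `pub-ymgap-dag-n04-b`
gen 3, LOCATED-2 / INTENT-2 (INBOX, after l.11604).  WHY THIS FILE.  The Theorem-4 knit's Proposition-5 step obtains the (1.29)-clause for
the composite `u₁·e^{iλ′}` by INVERSION (route (a″), `pub-ymgap-dag-n05-a` ruling INBOX l.11309): `(1.29) for u₁·v ⟺ (1.29) for v⁻¹u₁⁻¹`,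
then [3] Prop. 10 / (1.78)–(1.79) for the pair `(v⁻¹, u₁⁻¹)` (this seat's g2 `B8Restr129Inversion`, used by `B8Prop5JoinHFP.hFP_kLevel_of179`).
That g2 module inverts the averages GLOBALLY (p05 `B8Eq1112Quotient.uavg_inv` under (167) at EVERY block of `ℤᵈ`), so JOIN-B displays
GLOBAL (167)-binders for the inverse pair and `Restr129 … u₁⁻¹`.  Print needs (167) only on the block towers under `𝔅_k` ((1.73)/(1.74)
p. 89: `x_n ∈ B(x_{n+1})`, `x_{n+1} ∈ B^{j−n−1}(Λ_j)`), and at a background `U₀ ∈ 𝔄_k({Ω_j})` nothing controls `Ū₀ⁱ` off `Ω_i` — the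
global binders are over-strong (a located item on this seat's own lemma, not a gap in print).  THIS FILE gives the TOWER-LOCAL chain, every
`u₁`-hypothesis read through the `Λ_j`-WITNESSES of `B8SectEInLambdaWitness` (a global `ũ ∈ Λ_j(π^*U₀, α₃)` agreeing with `u₁` on `Bʲ(y)`;
`π^*U₀` = clamped background), so that at the end the Theorem-4 driver's clause `Restr129 L k Λ U₀ (u₁ * (e^{λ})⁻¹)` follows from
«`Q′(u₁⁻¹, λ) = 0` on `𝔅_k`» (`Cond179`, Sect. E's output for the inverse pair) under hypotheses AT `u₁` only ((1.29), unitary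
witnesses — e.g. `witness_of_axial` from `InAx` + `Restr129` — (1.33) on the towers, (207)-local `λ`), nothing global, nothing at `u₁⁻¹`.
Kind «kernel-checked proof», theorems only: no `def`, no `… : Prop` fact, no existing module modified.  REUSED BY NAME (nothing restated):
p05 `B8Eq1112Quotient.{uavg_inv, inLambda_inv}`, this seat's `B8Ineq172Concrete.uavg_congr_tower`, `B8Eq1115Concrete.utilG_congr_tower`,
`B8SectEInLambdaWitness.witness_inv_of_unitary`, r04 `B7Prop10General.{prop10_general_of52, levels_of52}`,
`B7Prop10InLambda.inLambda_mul_of_prop10_general`, `B7Eq214.{ineq176_of_207, ineq177_of_207}`, `B8Eq178Averages.{restr129_iff_uavg,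
utilG_eq_uavg_mul_inv, util178_eq_utilG, cond178_of_cond179}`, `MatrixLog.exp_mlog`.

## THE PRINTED TEXT

B8 p. 90: «u₁ satisfies the conditions (1.29) and we may write these conditions for u′u₁ in the following way
ũ′ʲ = \overline{R₀u′u₁}{}^j(\overline{R₀u₁}{}^j)⁻¹ = 1 on Λ_j, j = 0, 1, …, k, (1.78) or equivalently as Q′(u₁, λ) = 0 on 𝔅_k (1.79)».
[3] p. 50: «**Proposition 10.** … (203) |ũ′ʲ⁻¹(c₋)(R̄ʲ_{0,c}ũ′ʲ)(c₊) − 1| < α₄Lʲη + C₄(…)(Lʲη)², (204) |ũ′ʲ(y) − 1| < C₆α₄».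

## WHAT IS CERTIFIED HERE (kernel; axioms `propext` / `Classical.choice` / `Quot.sound`)

* §1 **`uavg_inv_tower_of_witness`** — `\overline{R₀u⁻¹}ᵐ(z) = (\overline{R₀u}ᵐ(z))⁻¹` at every level-`m` site `z` of the tower under `y`,
  for any `u` with a `Λ_j`-witness at `(j, y)` (`α₃ < ½`; any complete normed algebra) — locality + p05's global inversion for the witness.
* §2 **`restr129_inv_of_witness`** — (1.29) for `u₁` + witnesses at every `(j, y ∈ Λ_j)` ⇒ (1.29) for `u₁⁻¹` (JOIN-B's `h129inv` from the
  datum); `restr129_inv_iff_of_witness`.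
* §3 **`prop10_tower_of_witness`** — (203)/(204) at every level-`m` site/bond of the tower for ANY `u₁` with a `Λ_j`-witness and `u′ = e^{λ}`
  with (207) on `Bʲ(y)` (r04 `prop10_general_of52` for the clamped data); **`dom178_tower_of_witness`** — `‖ũ′ᵐ(z) − 1‖ ≤ C₆·4α₄` (so `< 1`:
  the log-domain input `hdom` of (1.79) ⇒ (1.78)).
* §4 **`witness_mul_of207`** — a `Λ_j`-witness for the PRODUCT `e^{λ}·u₁` (constant `2C₆(α₃ + 4α₄)`) from one for `u₁` and (207)-local `λ`
  (r04 `inLambda_mul_of_prop10_general`: [3] p. 45 «the product u′u₁ belongs to some class Λ_k(O(1)(α₃ + α₄))»).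
* §5 **`restr129_mul_inv_of_cond179_local`** (C⋆, unitary data) — THE DRIVER'S (1.29)-CLAUSE BY THE LOCAL INVERSION ROUTE: `Restr129 L k Λ U₀ u₁`,
  unitary `Λ_j`-witnesses for `u₁` at `𝔅_k`, (1.33) on the towers, (207)-local `λ` at `4α₄`-windows, and «`Q′(u₁⁻¹, λ) = 0` on `𝔅_k`»
  (`Cond179 L k Λ U₀ (e^{λ}) u₁⁻¹`) ⇒ `Restr129 L k Λ U₀ (u₁ * (e^{λ})⁻¹)`.  With `λ := −iλ′` this is `Restr129 … (u₁ * e^{iλ′})`, the last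
  clause of HFP (`B8Prop5KLevelLetters.hP5_step_of_HFP`), from Sect. E's output for the inverse pair — no global (167), no `Restr129 u₁⁻¹`, no
  `hdom` left displayed.

## HONEST SCOPE — what is NOT claimed

(i) Constants/windows are the lineage's (r04's Prop-10 windows at `4α₄`, `C₆`, `C4G`; Prop-2's for the clamped background), merely sufficient.
(ii) The clamped background and the zero/constant extensions are the tree's DEVICE, not in print.  (iii) §5 needs unitary data (print:
`G ⊂ U(N)`).  (iv) Nothing of Prop. 5's contraction, the D*-identity, Sect. E's `D′`, or the letters of [4] is here; the JOIN modules
(`B8Prop5JoinHFP`, `B8Prop5JoinSectE`, dag-n19-b) own the assembly — this file only supplies the local lemma their v1.2 may switch to.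
Count-neutral; N05 NOT discharged; nothing continuum / ℝ⁴ / OS / mass-gap / Clay.
-/

noncomputable section

open NormedSpace Finset

namespace Literature.MathematicalPhysics.QuantumFieldTheory.Balaban1983to89.B8Restr129InversionLocal

open B7Prop1Explicit B7Prop2Explicit B7Prop3Flat B7Prop1Local B7Eq167Flat B7Eq167General
open MatrixLog (mlog exp_mlog)
open B7Eq170Flat (cj cj_apply val_Rc_eq_cj mlog_exp_of_le)
open B7Eq92Concrete (Rc mgauge)
open B7Eq84Concrete (uavg)
open B7Prop9Flat (C5' SiteBd)
open B7Prop9General (CovBondBd)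
open B7Prop10General (C6 C4G utilG prop10_general_of52 levels_of52)
open B7Prop10Flat (one_le_C5 C4'_nonneg C5'_nonneg)
open B7Prop10InLambda (inLambda_mul_of_prop10_general)
open B8Ineq130 (tlo thi inBox_of_le tlo_zero thi_zero)
open B8Ineq172Concrete (uavg_congr_tower)
open B8Eq1115Concrete (utilG_congr_tower)
open B8Eq119TwistedAxial (bgT InAx Restr129)
open B8Eq178Averages (util178 Qnl Cond178 Cond179 restr129_iff_uavg utilG_eq_uavg_mul_inv util178_eq_utilG cond178_of_cond179)
open B8Eq1112Quotient (uavg_inv)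
open B8SectEInLambdaWitness (witness_inv_of_unitary)

-- `Site` alone could resolve to the torus sites of `Setup.lean`; re-export the `ℤ^d` sites of `B7Prop1Explicit`.
export B7Prop1Explicit (Site)

variable {d : ℕ}

/-! ## §1 Inversion of the averages `\overline{R₀u}ᵐ` at the tower sites, from a `Λ_j`-witness -/

section Inv

variable {𝔸 : Type*} [NormedRing 𝔸] [NormedAlgebra ℂ 𝔸] [CompleteSpace 𝔸]
variable {L j : ℕ} {y : Site d} {U₀ : Site d → Fin d → 𝔸ˣ} {u ut : Site d → 𝔸ˣ} {α₃ : ℝ}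

/-- **`\overline{R₀u⁻¹}ᵐ(z) = (\overline{R₀u}ᵐ(z))⁻¹` ON THE TOWER UNDER `y`, FROM A `Λ_j`-WITNESS** — the tower-local form of p05's
`B8Eq1112Quotient.uavg_inv` ([3] p. 44 «all operations needed to define R̄₀uᵏ are done always in a case where proper expressions are
small»): if `u` agrees on the sites of `Bʲ(y)` with a global `ũ ∈ Λ_j(π^*U₀, α₃)`, `α₃ < ½`, then at every level-`m` site `z` of `Bⁿ(y)`
(`n + m = j`) the average of `u⁻¹` is the inverse of the average of `u` — by the locality of (79)/(80) on the tower (`uavg_congr_tower`, for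
`u` and for `u⁻¹`) and the GLOBAL inversion for the witness (its (167) holds at every block of `ℤᵈ` w.r.t. `π^*U₀`).  No hypothesis off the
tower on `u` or `U₀`. [cite: Balaban1985Averaging, (79)–(80) p.30, (167) p.44; Balaban1985RegularSpaces, (1.74) p.89] -/
theorem uavg_inv_tower_of_witness (hL1 : 1 ≤ L) (hα₃ : 0 ≤ α₃) (hα₃' : α₃ < 1 / 2)
    (hW : InLambda L (clampCfg (tlo L y j) (thi L y j) U₀) ut j α₃ (((L : ℝ) ^ j)⁻¹))
    (hu : ∀ x : Site d, tlo L y j ≤ x → x ≤ thi L y j → u x = ut x)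
    {m n : ℕ} (hmn : n + m = j) (z : Site d) (hz : tlo L y n ≤ z) (hz' : z ≤ thi L y n) :
    uavg L U₀ u⁻¹ m z = (uavg L U₀ u m z)⁻¹ := by
  have hLj : (0 : ℝ) < (L : ℝ) ^ j := by
    have : (1 : ℝ) ≤ L := by exact_mod_cast hL1
    positivity
  have h₀ : AgreeOn (tlo L y j) (thi L y j) U₀ (clampCfg (tlo L y j) (thi L y j) U₀) := (clampCfg_agree U₀).symm
  have huinv : ∀ x : Site d, tlo L y j ≤ x → x ≤ thi L y j → u⁻¹ x = ut⁻¹ x := fun x hx hx' => by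
    rw [Pi.inv_apply, Pi.inv_apply, hu x hx hx']
  have hs : α₃ * (L : ℝ) ^ j * ((L : ℝ) ^ j)⁻¹ < 1 / 2 := by
    rw [mul_assoc, mul_inv_cancel₀ hLj.ne', mul_one]; exact hα₃'
  have hglob := uavg_inv hW.2 hL1 (by positivity) hα₃ hs m (by omega)
  rw [uavg_congr_tower hL1 h₀ huinv m n hmn z hz hz', uavg_congr_tower hL1 h₀ hu m n hmn z hz hz', hglob, Pi.inv_apply]

end Inv

/-! ## §2 (1.29) for `u₁⁻¹` from (1.29) for `u₁`, witnesses at the constraint sites -/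

section Restr

variable {𝔸 : Type*} [NormedRing 𝔸] [NormedAlgebra ℂ 𝔸] [CompleteSpace 𝔸]
variable {L k : ℕ} {Λ : ℕ → Set (Site d)} {U₀ : Site d → Fin d → 𝔸ˣ} {u₁ : Site d → 𝔸ˣ} {α₃ : ℝ}

/-- **(1.29) AT `k` LEVELS FOR `u⁻¹` IFF FOR `u`, TOWER-LOCAL FORM** (this seat's g2 `B8Restr129Inversion.restr129_inv_iff` without the global
(167)): given a `Λ_j`-witness for `u` at every `(j, y ∈ Λ_j)` (`α₃ < ½`), `\overline{R₀u⁻¹}ʲ(y) = (\overline{R₀u}ʲ(y))⁻¹` at each constraint site,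
so one is `1` iff the other is. [cite: Balaban1985RegularSpaces, (1.29) p.81; Balaban1985Averaging, (79)–(80) p.30, (167) p.44] -/
theorem restr129_inv_iff_of_witness (hL1 : 1 ≤ L) (hα₃ : 0 ≤ α₃) (hα₃' : α₃ < 1 / 2)
    (hwit : ∀ j, j ≤ k → ∀ y ∈ Λ j, ∃ ut : Site d → 𝔸ˣ,
      InLambda L (clampCfg (tlo L y j) (thi L y j) U₀) ut j α₃ (((L : ℝ) ^ j)⁻¹) ∧
      ∀ x : Site d, tlo L y j ≤ x → x ≤ thi L y j → u₁ x = ut x) :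
    Restr129 L k Λ U₀ u₁⁻¹ ↔ Restr129 L k Λ U₀ u₁ := by
  rw [restr129_iff_uavg, restr129_iff_uavg]
  refine forall_congr' fun j => forall_congr' fun hj => forall_congr' fun y => forall_congr' fun hy => ?_
  obtain ⟨ut, hW, hag⟩ := hwit j hj y hy
  have hy₀ : tlo L y 0 ≤ y := by rw [tlo_zero]
  have hy₀' : y ≤ thi L y 0 := by rw [thi_zero]
  rw [uavg_inv_tower_of_witness hL1 hα₃ hα₃' hW hag (m := j) (n := 0) (by omega) y hy₀ hy₀', inv_eq_one]

/-- **(1.29) FOR `u₁⁻¹` FROM (1.29) FOR `u₁`** (JOIN-B's binder `h129inv`, from the datum): witnesses at every `(j, y ∈ Λ_j)` suffice; no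
global hypothesis. [cite: Balaban1985RegularSpaces, (1.29) p.81, (1.68) p.88] -/
theorem restr129_inv_of_witness (hL1 : 1 ≤ L) (hα₃ : 0 ≤ α₃) (hα₃' : α₃ < 1 / 2)
    (hwit : ∀ j, j ≤ k → ∀ y ∈ Λ j, ∃ ut : Site d → 𝔸ˣ,
      InLambda L (clampCfg (tlo L y j) (thi L y j) U₀) ut j α₃ (((L : ℝ) ^ j)⁻¹) ∧
      ∀ x : Site d, tlo L y j ≤ x → x ≤ thi L y j → u₁ x = ut x)
    (h129 : Restr129 L k Λ U₀ u₁) : Restr129 L k Λ U₀ u₁⁻¹ :=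
  (restr129_inv_iff_of_witness hL1 hα₃ hα₃' hwit).2 h129

end Restr

/-! ## §3 Proposition 10 (203)/(204) on the tower for any `u₁` with a `Λ_j`-witness -/

section Prop10

variable {𝔸 : Type*} [NormedRing 𝔸] [NormOneClass 𝔸] [NormedAlgebra ℂ 𝔸] [CompleteSpace 𝔸]
variable {L : ℕ} {G : Subgroup 𝔸ˣ} {j : ℕ} {y : Site d} {U₀ : Site d → Fin d → 𝔸ˣ} {α₀ α₃ α₄ : ℝ} {lam : Site d → 𝔸}
  {u₁ ut : Site d → 𝔸ˣ}

/-- (207) on the tower for `λ` ⇒ the global (176)/(177) for `e^{λ∘π}` w.r.t. the clamped background (constant `4α₄`, scale `L^{−j}`) — the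
(207) ⇒ (176)/(177) step of [3] p. 50 (`B7Eq214.ineq176_of_207` / `ineq177_of_207`) for the extended data. [cite: Balaban1985Averaging, (207) p.50, (176)–(177) p.45] -/
private theorem h176_177_clamp (hL1 : 1 ≤ L) (hα₄ : 0 < α₄) (hα₄' : α₄ ≤ 1 / 4)
    (h177b : ∀ x : Site d, InBox (tlo L y j) (thi L y j) x → ‖lam x‖ < α₄)
    (h177a : ∀ (x : Site d) (κ : Fin d), InBox (tlo L y j) (thi L y j) x → InBox (tlo L y j) (thi L y j) (x + e κ) →
      ‖cj (U₀ x κ) (lam (x + e κ)) - lam x‖ < α₄ * ((L : ℝ) ^ j)⁻¹) :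
    SiteBd (fun x => expUnit (lam (clamp (tlo L y j) (thi L y j) x))) (4 * α₄) ∧
      CovBondBd (clampCfg (tlo L y j) (thi L y j) U₀) (fun x => expUnit (lam (clamp (tlo L y j) (thi L y j) x)))
        (4 * α₄ * ((L : ℝ) ^ j)⁻¹) := by
  have hlohi : ∀ i, tlo L y j i ≤ thi L y j i := B8Ineq130.tlo_le_thi hL1 le_rfl j
  have hLr : (1 : ℝ) ≤ L := by exact_mod_cast hL1
  have hη1 : ((L : ℝ) ^ j)⁻¹ ≤ 1 := inv_le_one_of_one_le₀ (one_le_pow₀ hLr)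
  have hb : ∀ x : Site d, ‖lam (clamp (tlo L y j) (thi L y j) x)‖ < α₄ := fun x => h177b _ (clamp_inBox hlohi x)
  have ha : ∀ (x : Site d) (κ : Fin d), ‖cj (clampCfg (tlo L y j) (thi L y j) U₀ x κ) (lam (clamp (tlo L y j) (thi L y j) (x + e κ))) -
      lam (clamp (tlo L y j) (thi L y j) x)‖ < α₄ * ((L : ℝ) ^ j)⁻¹ := by
    intro x κ
    by_cases hP : tlo L y j κ ≤ x κ ∧ x κ < thi L y j κ
    · have hx := clamp_inBox hlohi x
      have hxe : InBox (tlo L y j) (thi L y j) (clamp (tlo L y j) (thi L y j) x + e κ) := by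
        rw [← clamp_add_e_of hP]; exact clamp_inBox hlohi _
      simp only [clampCfg, hP, and_self, if_true, clamp_add_e_of hP]
      exact h177a _ κ hx hxe
    · simp only [clampCfg, hP, if_false, clamp_add_e_of_not (hlohi κ) hP, cj_apply, Units.val_one, inv_one, one_mul, mul_one,
        sub_self, norm_zero]
      positivity
  refine ⟨fun x => ?_, fun x κ => ?_⟩
  · show ‖((expUnit (lam (clamp (tlo L y j) (thi L y j) x)) : 𝔸ˣ) : 𝔸) - 1‖ ≤ 4 * α₄
    rw [val_expUnit]
    exact (B7Eq214.ineq176_of_207 _ hα₄' (hb x)).le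
  · show ‖((((expUnit (lam (clamp (tlo L y j) (thi L y j) x)))⁻¹ *
        Rc (clampCfg (tlo L y j) (thi L y j) U₀ x κ) (expUnit (lam (clamp (tlo L y j) (thi L y j) (x + e κ)))) : 𝔸ˣ)) : 𝔸) - 1‖ ≤
      4 * α₄ * ((L : ℝ) ^ j)⁻¹
    rw [Units.val_mul, val_inv_expUnit, val_Rc_eq_cj, val_expUnit, val_expUnit, cj_apply]
    exact (B7Eq214.ineq177_of_207 _ _ _ hα₄' hη1 (hb x) (ha x κ)).le

/-- **(203)/(204) OF [3] ON THE TOWER FOR ANY `u₁` WITH A `Λ_j`-WITNESS** (B8 pp. 89–90: «the assumptions of Proposition 10 … hold»): for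
`u′ = e^{λ}` with (207) on `Bʲ(y)` (`‖λ(x)‖ < α₄`, `‖R(U₀(b))λ(b₊) − λ(b₋)‖ < α₄L^{−j}`), `u₁` agreeing on `Bʲ(y)` with a global
`ũ ∈ Λ_j(π^*U₀, α₃)`, `U₀` `G`-valued and regular on `Bʲ(y)` ((1.33)), and r04's Prop-10 windows at `(α₃, 4α₄)`: at every level-`m` site
`z ∈ Bⁿ(y)` (`n + m = j`), (204) `‖ũ′ᵐ(z) − 1‖ ≤ C₆·(4α₄)`, and at every level-`m` bond `⟨z, z + e_κ⟩` inside `Bⁿ(y)`, (203)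
`‖ũ′ᵐ(z)⁻¹R(Ū₀ᵐ(z, κ))ũ′ᵐ(z + e_κ) − 1‖ ≤ 2(4α₄)·Lᵐ·L^{−j}` (this seat's g0 `B8Eq178Local.prop10_local` with «`u₁ = glev_j`» replaced by the
witness). [cite: Balaban1985RegularSpaces, p.89, (1.77) p.90; Balaban1985Averaging, Proposition 10 (203)–(204) p.50, (207) p.50] -/
theorem prop10_tower_of_witness (hL : 2 ≤ L) (hG : AvgClosed d L G) (hU₀ : ∀ x κ, U₀ x κ ∈ G)
    (hα : 0 < α₀) (hα3 : C0 d * α₀ ≤ 1 / 3) (hα2 : 2 * α₀ ≤ c2' d L)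
    (h33 : pdevOn (tlo L y j) (thi L y j) U₀ < α₀ * (((L : ℝ) ^ j)⁻¹) ^ 2) (hL1 : 1 ≤ L)
    (hW : InLambda L (clampCfg (tlo L y j) (thi L y j) U₀) ut j α₃ (((L : ℝ) ^ j)⁻¹))
    (hu₁ : ∀ x : Site d, tlo L y j ≤ x → x ≤ thi L y j → u₁ x = ut x)
    (hα₄ : 0 < α₄) (h177b : ∀ x : Site d, InBox (tlo L y j) (thi L y j) x → ‖lam x‖ < α₄)
    (h177a : ∀ (x : Site d) (κ : Fin d), InBox (tlo L y j) (thi L y j) x → InBox (tlo L y j) (thi L y j) (x + e κ) →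
      ‖cj (U₀ x κ) (lam (x + e κ)) - lam x‖ < α₄ * ((L : ℝ) ^ j)⁻¹)
    (hα₃ : 0 ≤ α₃) (hα₃' : α₃ ≤ 1 / 50)
    (hs₁ : 10 * C6 d * (4 * α₄) ≤ 1) (hs₂ : 3000 * ((d : ℝ) + 1) * L * (4 * α₄) ≤ 1) (hs₃ : C4G d L * (α₀ + α₃ + 4 * α₄) ≤ 1)
    (hs₄ : 1024 * ((d : ℝ) + 1) * ((d : ℝ) + 4) * L ^ 2 * α₀ ≤ 1) (hs₅ : 32 * ((d : ℝ) + 1) ^ 2 * C6 d * L ^ 2 * α₀ ≤ 1)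
    (hs₆ : 16 * d * C5' d * C6 d * (L : ℝ) ^ 2 * α₀ ≤ 1)
    {m n : ℕ} (hmn : n + m = j) :
    (∀ z : Site d, tlo L y n ≤ z → z ≤ thi L y n →
        ‖((utilG L U₀ (fun x => expUnit (lam x)) u₁ m z : 𝔸ˣ) : 𝔸) - 1‖ ≤ C6 d * (4 * α₄)) ∧
      ∀ (z : Site d) (κ : Fin d), tlo L y n ≤ z → z + e κ ≤ thi L y n →
        ‖((((utilG L U₀ (fun x => expUnit (lam x)) u₁ m z)⁻¹
            * Rc (avgIter L U₀ m z κ) (utilG L U₀ (fun x => expUnit (lam x)) u₁ m (z + e κ)) : 𝔸ˣ)) : 𝔸) - 1‖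
          ≤ 2 * (4 * α₄) * ((L : ℝ) ^ m * ((L : ℝ) ^ j)⁻¹) := by
  have hlohi : ∀ i, tlo L y j i ≤ thi L y j i := B8Ineq130.tlo_le_thi hL1 le_rfl j
  have hUU : ∀ x κ, U₀ x κ ∈ U1 𝔸 := fun x κ => hG.le_U1 (hU₀ x κ)
  have hLj : (0 : ℝ) < (L : ℝ) ^ j := by positivity
  have hC6 : (2 : ℝ) ≤ C6 d := by unfold C6; linarith [one_le_C5 (d := d)]
  have hα₄' : α₄ ≤ 1 / 4 := by nlinarith
  -- the extended data
  set U₀c := clampCfg (tlo L y j) (thi L y j) U₀ with hU₀c_def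
  set lamc : Site d → 𝔸 := fun x => lam (clamp (tlo L y j) (thi L y j) x) with hlamc_def
  have hU₀c : ∀ x κ, U₀c x κ ∈ G := clampCfg_mem hU₀
  have h52c : pdev U₀c < α₀ * (((L : ℝ) ^ j)⁻¹) ^ 2 := (pdev_clampCfg_le hlohi hUU).trans_lt h33
  have h₀ : AgreeOn (tlo L y j) (thi L y j) U₀ U₀c := (clampCfg_agree U₀).symm
  obtain ⟨h176, h177⟩ := h176_177_clamp (U₀ := U₀) (lam := lam) hL1 hα₄ hα₄' h177b h177a
  -- the GLOBAL (203)/(204) for the clamped data and the witness, `k ↦ j`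
  have hP := prop10_general_of52 hL hG hU₀c hα hα3 hα2 h52c h176 h177 hW hα₃ hα₃' (by positivity) hs₁ hs₂ hs₃ hs₄ hs₅ hs₆ m
    (by omega)
  -- transfer to the original data on the tower
  have hu' : ∀ x : Site d, tlo L y j ≤ x → x ≤ thi L y j → (fun x => expUnit (lam x)) x = (fun x => expUnit (lamc x)) x :=
    fun x hx hx' => by simp only [hlamc_def, clamp_of_inBox (inBox_of_le hx hx')]
  refine ⟨fun z hz hz' => ?_, fun z κ hz hz' => ?_⟩
  · rw [utilG_congr_tower hL1 h₀ hu' hu₁ m n hmn z hz hz']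
    exact hP.2 z
  · have hze : z ≤ thi L y n := fun i => by
      have := hz' i; rw [Pi.add_apply] at this
      have he : 0 ≤ e κ i := by rw [B7Prop1Explicit.e_apply]; split_ifs <;> norm_num
      linarith
    have hze' : tlo L y n ≤ z + e κ := fun i => by
      have := hz i; rw [Pi.add_apply]
      have he : 0 ≤ e κ i := by rw [B7Prop1Explicit.e_apply]; split_ifs <;> norm_num
      linarith
    rw [utilG_congr_tower hL1 h₀ hu' hu₁ m n hmn z hz hze, utilG_congr_tower hL1 h₀ hu' hu₁ m n hmn (z + e κ) hze' hz',
      B8Ineq172Concrete.avgIter_agree_tower hL1 h₀ hmn z κ (inBox_of_le hz hze) (inBox_of_le hze' hz')]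
    exact hP.1 z κ

/-- **`‖ũ′ᵐ(z) − 1‖ ≤ C₆·4α₄` ON THE TOWER FOR ANY `u₁` WITH A `Λ_j`-WITNESS** — (204) alone, in the `util178` currency of (1.78): with
`10·C₆·4α₄ ≤ 1` this is `< 1`, the log-domain condition under which (1.79) `Q′(u₁, λ) = 0` gives back (1.78) `ũ′ = 1`
(`B8Eq178Averages.cond178_of_cond179`) — JOIN-B's `hdom`, here tower-local and for any `u₁` with a witness (e.g. `u₁⁻¹`).
[cite: Balaban1985RegularSpaces, (1.78)–(1.79) p.90; Balaban1985Averaging, (204) p.50] -/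
theorem dom178_tower_of_witness (hL : 2 ≤ L) (hG : AvgClosed d L G) (hU₀ : ∀ x κ, U₀ x κ ∈ G)
    (hα : 0 < α₀) (hα3 : C0 d * α₀ ≤ 1 / 3) (hα2 : 2 * α₀ ≤ c2' d L)
    (h33 : pdevOn (tlo L y j) (thi L y j) U₀ < α₀ * (((L : ℝ) ^ j)⁻¹) ^ 2) (hL1 : 1 ≤ L)
    (hW : InLambda L (clampCfg (tlo L y j) (thi L y j) U₀) ut j α₃ (((L : ℝ) ^ j)⁻¹))
    (hu₁ : ∀ x : Site d, tlo L y j ≤ x → x ≤ thi L y j → u₁ x = ut x)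
    (hα₄ : 0 < α₄) (h177b : ∀ x : Site d, InBox (tlo L y j) (thi L y j) x → ‖lam x‖ < α₄)
    (h177a : ∀ (x : Site d) (κ : Fin d), InBox (tlo L y j) (thi L y j) x → InBox (tlo L y j) (thi L y j) (x + e κ) →
      ‖cj (U₀ x κ) (lam (x + e κ)) - lam x‖ < α₄ * ((L : ℝ) ^ j)⁻¹)
    (hα₃ : 0 ≤ α₃) (hα₃' : α₃ ≤ 1 / 50)
    (hs₁ : 10 * C6 d * (4 * α₄) ≤ 1) (hs₂ : 3000 * ((d : ℝ) + 1) * L * (4 * α₄) ≤ 1) (hs₃ : C4G d L * (α₀ + α₃ + 4 * α₄) ≤ 1)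
    (hs₄ : 1024 * ((d : ℝ) + 1) * ((d : ℝ) + 4) * L ^ 2 * α₀ ≤ 1) (hs₅ : 32 * ((d : ℝ) + 1) ^ 2 * C6 d * L ^ 2 * α₀ ≤ 1)
    (hs₆ : 16 * d * C5' d * C6 d * (L : ℝ) ^ 2 * α₀ ≤ 1)
    {m n : ℕ} (hmn : n + m = j) (z : Site d) (hz : tlo L y n ≤ z) (hz' : z ≤ thi L y n) :
    ‖util178 L U₀ (fun x => expUnit (lam x)) u₁ m z - 1‖ ≤ C6 d * (4 * α₄) := by
  rw [util178_eq_utilG]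
  exact (prop10_tower_of_witness hL hG hU₀ hα hα3 hα2 h33 hL1 hW hu₁ hα₄ h177b h177a hα₃ hα₃' hs₁ hs₂ hs₃ hs₄ hs₅ hs₆ hmn).1 z
    hz hz'

end Prop10

/-! ## §4 A `Λ_j`-witness for the product `e^{λ}·u₁` -/

section Mul

variable {𝔸 : Type*} [NormedRing 𝔸] [NormOneClass 𝔸] [NormedAlgebra ℂ 𝔸] [CompleteSpace 𝔸]
variable {L : ℕ} {G : Subgroup 𝔸ˣ} {j : ℕ} {y : Site d} {U₀ : Site d → Fin d → 𝔸ˣ} {α₀ α₃ α₄ : ℝ} {lam : Site d → 𝔸}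
  {u₁ ut : Site d → 𝔸ˣ}

/-- **A `Λ_j`-WITNESS FOR THE PRODUCT `e^{λ}·u₁`** ([3] p. 45 «if u′ is such a configuration and u₁ belongs to a class Λ_k(α₃), then the
product u′u₁ belongs to some class Λ_k(O(1)(α₃ + α₄))», r04 `B7Prop10InLambda.inLambda_mul_of_prop10_general`), tower-local: from a
witness `ũ` for `u₁` at `(j, y)` (constant `α₃`) and (207) for `λ` on `Bʲ(y)`, the global product `e^{λ∘π}·ũ` lies in
`Λ_j(π^*U₀, 2C₆(α₃ + 4α₄))` and agrees with `e^{λ}·u₁` on `Bʲ(y)`.  Windows: r04's Prop-10 windows at `(α₃, 4α₄)` + Prop. 2's for the clamped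
background. [cite: Balaban1985Averaging, p.45 (after (177)), Proposition 10 p.50, (178) p.45] -/
theorem witness_mul_of207 (hL : 2 ≤ L) (hG : AvgClosed d L G) (hU₀ : ∀ x κ, U₀ x κ ∈ G)
    (hα : 0 < α₀) (hα3 : C0 d * α₀ ≤ 1 / 3) (hα2 : 2 * α₀ ≤ c2' d L)
    (h33 : pdevOn (tlo L y j) (thi L y j) U₀ < α₀ * (((L : ℝ) ^ j)⁻¹) ^ 2) (hL1 : 1 ≤ L)
    (hW : InLambda L (clampCfg (tlo L y j) (thi L y j) U₀) ut j α₃ (((L : ℝ) ^ j)⁻¹))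
    (hu₁ : ∀ x : Site d, tlo L y j ≤ x → x ≤ thi L y j → u₁ x = ut x)
    (hα₄ : 0 < α₄) (h177b : ∀ x : Site d, InBox (tlo L y j) (thi L y j) x → ‖lam x‖ < α₄)
    (h177a : ∀ (x : Site d) (κ : Fin d), InBox (tlo L y j) (thi L y j) x → InBox (tlo L y j) (thi L y j) (x + e κ) →
      ‖cj (U₀ x κ) (lam (x + e κ)) - lam x‖ < α₄ * ((L : ℝ) ^ j)⁻¹)
    (hα₃ : 0 ≤ α₃) (hα₃' : α₃ ≤ 1 / 50)
    (hs₁ : 10 * C6 d * (4 * α₄) ≤ 1) (hs₂ : 3000 * ((d : ℝ) + 1) * L * (4 * α₄) ≤ 1) (hs₃ : C4G d L * (α₀ + α₃ + 4 * α₄) ≤ 1)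
    (hs₄ : 1024 * ((d : ℝ) + 1) * ((d : ℝ) + 4) * L ^ 2 * α₀ ≤ 1) (hs₅ : 32 * ((d : ℝ) + 1) ^ 2 * C6 d * L ^ 2 * α₀ ≤ 1)
    (hs₆ : 16 * d * C5' d * C6 d * (L : ℝ) ^ 2 * α₀ ≤ 1) :
    ∃ wt : Site d → 𝔸ˣ, InLambda L (clampCfg (tlo L y j) (thi L y j) U₀) wt j (2 * C6 d * (α₃ + 4 * α₄)) (((L : ℝ) ^ j)⁻¹) ∧
      ∀ x : Site d, tlo L y j ≤ x → x ≤ thi L y j → ((fun x => expUnit (lam x)) * u₁) x = wt x := by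
  have hlohi : ∀ i, tlo L y j i ≤ thi L y j i := B8Ineq130.tlo_le_thi hL1 le_rfl j
  have hUU : ∀ x κ, U₀ x κ ∈ U1 𝔸 := fun x κ => hG.le_U1 (hU₀ x κ)
  have hLr : (1 : ℝ) ≤ L := by exact_mod_cast hL1
  have hLj : (0 : ℝ) < (L : ℝ) ^ j := by positivity
  have hC6 : (2 : ℝ) ≤ C6 d := by unfold C6; linarith [one_le_C5 (d := d)]
  have hα₄' : α₄ ≤ 1 / 4 := by nlinarith
  set U₀c := clampCfg (tlo L y j) (thi L y j) U₀ with hU₀c_def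
  have hU₀c : ∀ x κ, U₀c x κ ∈ G := clampCfg_mem hU₀
  have h52c : pdev U₀c < α₀ * (((L : ℝ) ^ j)⁻¹) ^ 2 := (pdev_clampCfg_le hlohi hUU).trans_lt h33
  obtain ⟨h176, h177⟩ := h176_177_clamp (U₀ := U₀) (lam := lam) hL1 hα₄ hα₄' h177b h177a
  obtain ⟨hV, hPl⟩ := levels_of52 hL hG hU₀c j hα hα3 hα2 h52c
  have hη : (0 : ℝ) ≤ ((L : ℝ) ^ j)⁻¹ := by positivity
  have hk : (L : ℝ) ^ j * ((L : ℝ) ^ j)⁻¹ ≤ 1 := by rw [mul_inv_cancel₀ hLj.ne']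
  have hΛ := inLambda_mul_of_prop10_general hL (fun i hi => hV i hi.le) (fun i hi => hPl i hi.le) h176 h177 hW hη hk hα.le hα₃ hα₃'
    (by positivity) hs₁ hs₂ hs₃ hs₄ hs₅ hs₆
  refine ⟨_, hΛ, fun x hx hx' => ?_⟩
  rw [Pi.mul_apply, Pi.mul_apply, hu₁ x hx hx', clamp_of_inBox (inBox_of_le hx hx')]

end Mul

/-! ## §5 The driver's (1.29)-clause by the LOCAL inversion route -/

section Driver

variable {𝔸 : Type*} [CStarAlgebra 𝔸] [Nontrivial 𝔸]
variable {L k : ℕ} {Λ : ℕ → Set (Site d)} {U₀ : Site d → Fin d → 𝔸ˣ} {α₀ α₃ α₄ : ℝ} {lam : Site d → 𝔸} {u₁ : Site d → 𝔸ˣ}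

/-- **THE THEOREM-4 DRIVER'S (1.29)-CLAUSE BY INVERSION, TOWER-LOCAL HYPOTHESES ONLY** (route (a″) of the knit, `pub-ymgap-dag-n05-a` ruling;
this seat's g2 `restr129_mul_gaugeExp_of_cond179_neg` without its GLOBAL (167)/`hdom` binders and without `Restr129 … u₁⁻¹`): let `u₁` satisfy
(1.29) at `k` levels (`Restr129`) and have at every `(j, y ∈ Λ_j)` a UNITARY `Λ_j`-witness (constant `α₃`; e.g. `witness_unitary_of_glev` /
`witness_of_axial` for Theorem 4's inductive `u₁`), `U₀` unitary-valued with (1.33) on the towers, `λ` with (207) on the towers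
(`‖λ‖ < α₄`, covariant differences `< α₄L^{−j}`), and suppose Sect. E's output for the INVERSE pair: «`Q′(u₁⁻¹, λ) = 0` on `𝔅_k`»
(`Cond179 L k Λ U₀ e^{λ} u₁⁻¹`).  THEN `u₁·(e^{λ})⁻¹` satisfies (1.29) at `k` levels.  PROOF at a constraint site `y ∈ Λ_j`: the product
`w = e^{λ}u₁⁻¹` has the witness of §4 built on `ũ⁻¹` (`witness_inv_of_unitary`), so `\overline{R₀(u₁e^{−λ})}ʲ(y) = \overline{R₀w⁻¹}ʲ(y) =
(\overline{R₀w}ʲ(y))⁻¹` (§1); `\overline{R₀w}ʲ = ũ′ʲ·\overline{R₀u₁⁻¹}ʲ` ((178)); `\overline{R₀u₁⁻¹}ʲ(y) = (\overline{R₀u₁}ʲ(y))⁻¹ = 1` (§1, (1.29));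
`ũ′ʲ(y) = 1` by (1.79) ⇒ (1.78) on the log domain (§3, `‖ũ′ʲ(y) − 1‖ ≤ 4C₆α₄ < 1`).  With `λ := −iλ′` the conclusion reads
`Restr129 … (u₁ * e^{iλ′})`, HFP's last clause. [cite: Balaban1985RegularSpaces, (1.29) p.81, (1.78)–(1.79) p.90, p.94 («u = u′u₁»), (1.112) p.95; Balaban1985Averaging, (178) p.45, Prop. 10 (204) p.50] -/
theorem restr129_mul_inv_of_cond179_local (hL : 2 ≤ L) (hL1 : 1 ≤ L) (hU₀ : ∀ x κ, U₀ x κ ∈ unitaryUnits 𝔸)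
    (hα : 0 < α₀) (hα3 : C0 d * α₀ ≤ 1 / 3) (hα2 : 2 * α₀ ≤ c2' d L) (hα₃ : 0 ≤ α₃) (hα₃' : α₃ ≤ 1 / 50) (hα₄ : 0 < α₄)
    (h33 : ∀ j, j ≤ k → ∀ y ∈ Λ j, pdevOn (tlo L y j) (thi L y j) U₀ < α₀ * (((L : ℝ) ^ j)⁻¹) ^ 2)
    (hwit : ∀ j, j ≤ k → ∀ y ∈ Λ j, ∃ ut : Site d → 𝔸ˣ, (∀ x, ut x ∈ unitaryUnits 𝔸) ∧
      InLambda L (clampCfg (tlo L y j) (thi L y j) U₀) ut j α₃ (((L : ℝ) ^ j)⁻¹) ∧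
      ∀ x : Site d, tlo L y j ≤ x → x ≤ thi L y j → u₁ x = ut x)
    (h177b : ∀ j, j ≤ k → ∀ y ∈ Λ j, ∀ x : Site d, InBox (tlo L y j) (thi L y j) x → ‖lam x‖ < α₄)
    (h177a : ∀ j, j ≤ k → ∀ y ∈ Λ j, ∀ (x : Site d) (κ : Fin d), InBox (tlo L y j) (thi L y j) x →
      InBox (tlo L y j) (thi L y j) (x + e κ) → ‖cj (U₀ x κ) (lam (x + e κ)) - lam x‖ < α₄ * ((L : ℝ) ^ j)⁻¹)
    (hs₁ : 10 * C6 d * (4 * α₄) ≤ 1) (hs₂ : 3000 * ((d : ℝ) + 1) * L * (4 * α₄) ≤ 1) (hs₃ : C4G d L * (α₀ + α₃ + 4 * α₄) ≤ 1)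
    (hs₄ : 1024 * ((d : ℝ) + 1) * ((d : ℝ) + 4) * L ^ 2 * α₀ ≤ 1) (hs₅ : 32 * ((d : ℝ) + 1) ^ 2 * C6 d * L ^ 2 * α₀ ≤ 1)
    (hs₆ : 16 * d * C5' d * C6 d * (L : ℝ) ^ 2 * α₀ ≤ 1)
    (hprod : 2 * C6 d * (α₃ + 4 * α₄) < 1 / 2)
    (h129 : Restr129 L k Λ U₀ u₁) (h179 : Cond179 L k Λ U₀ (fun x => expUnit (lam x)) u₁⁻¹) :
    Restr129 L k Λ U₀ (u₁ * (fun x => expUnit (lam x))⁻¹) := by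
  have hG := avgClosed_unitaryUnits d L (𝔸 := 𝔸)
  have hC6 : (2 : ℝ) ≤ C6 d := by unfold C6; linarith [one_le_C5 (d := d)]
  have hα₃h : α₃ < 1 / 2 := by linarith
  have hα₃q : α₃ ≤ 1 / 4 := by linarith
  rw [restr129_iff_uavg]
  intro j hj y hy
  obtain ⟨ut, hun, hW, hag⟩ := hwit j hj y hy
  have hy₀ : tlo L y 0 ≤ y := by rw [tlo_zero]
  have hy₀' : y ≤ thi L y 0 := by rw [thi_zero]
  -- the witness `ũ⁻¹` for `u₁⁻¹` and the witness of §4 for the product `w = e^{λ}·u₁⁻¹`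
  obtain ⟨uti, hWi, hagi⟩ := witness_inv_of_unitary hL hU₀ hα hα3 hα2 (h33 j hj y hy) hL1 hα₃ hα₃q hun hW hag
  obtain ⟨wt, hWw, hagw⟩ := witness_mul_of207 hL hG hU₀ hα hα3 hα2 (h33 j hj y hy) hL1 hWi hagi hα₄ (h177b j hj y hy) (h177a j hj y hy)
    hα₃ hα₃' hs₁ hs₂ hs₃ hs₄ hs₅ hs₆
  -- `u₁·(e^{λ})⁻¹ = w⁻¹`
  have hinv : u₁ * (fun x => expUnit (lam x))⁻¹ = ((fun x => expUnit (lam x)) * u₁⁻¹)⁻¹ := by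
    rw [mul_inv_rev, inv_inv]
  -- §1 twice: `\overline{R₀w⁻¹}ʲ(y) = (\overline{R₀w}ʲ(y))⁻¹`, `\overline{R₀u₁⁻¹}ʲ(y) = (\overline{R₀u₁}ʲ(y))⁻¹ = 1`
  have h1 := uavg_inv_tower_of_witness (u := (fun x => expUnit (lam x)) * u₁⁻¹) hL1 (by positivity) hprod hWw hagw (m := j) (n := 0)
    (by omega) y hy₀ hy₀'
  have h2 := uavg_inv_tower_of_witness (u := u₁) hL1 hα₃ hα₃h hW hag (m := j) (n := 0) (by omega) y hy₀ hy₀'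
  have h129y : uavg L U₀ u₁ j y = 1 := (restr129_iff_uavg L k Λ U₀ u₁).1 h129 j hj y hy
  -- (204) on the tower for `u₁⁻¹` ⇒ the log domain; (1.79) ⇒ (1.78): `ũ′ʲ(y) = 1`
  have hdom : ‖util178 L U₀ (fun x => expUnit (lam x)) u₁⁻¹ j y - 1‖ < 1 := by
    have h := dom178_tower_of_witness hL hG hU₀ hα hα3 hα2 (h33 j hj y hy) hL1 hWi hagi hα₄ (h177b j hj y hy) (h177a j hj y hy) hα₃
      hα₃' hs₁ hs₂ hs₃ hs₄ hs₅ hs₆ (m := j) (n := 0) (by omega) y hy₀ hy₀'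
    have : C6 d * (4 * α₄) ≤ 1 / 10 := by nlinarith
    linarith
  have h178 : util178 L U₀ (fun x => expUnit (lam x)) u₁⁻¹ j y = 1 := by
    have h0 : mlog (util178 L U₀ (fun x => expUnit (lam x)) u₁⁻¹ j y) = 0 := h179 j hj y hy
    rw [← exp_mlog hdom, h0, exp_zero]
  have hutil : utilG L U₀ (fun x => expUnit (lam x)) u₁⁻¹ j y = 1 := by
    rw [util178_eq_utilG, Units.val_eq_one] at h178; exact h178
  -- assemble: `\overline{R₀w}ʲ(y) = ũ′ʲ(y)·\overline{R₀u₁⁻¹}ʲ(y) = 1·1`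
  have hw : uavg L U₀ ((fun x => expUnit (lam x)) * u₁⁻¹) j y = 1 := by
    have h := congrFun (utilG_eq_uavg_mul_inv L U₀ (fun x => expUnit (lam x)) u₁⁻¹ j) y
    rw [hutil, h2, h129y, inv_one] at h
    simp only [inv_one, mul_one] at h
    exact h.symm
  rw [hinv, h1, hw, inv_one]

end Driver

#print axioms uavg_inv_tower_of_witness
#print axioms restr129_inv_iff_of_witness
#print axioms restr129_inv_of_witness
#print axioms prop10_tower_of_witness
#print axioms dom178_tower_of_witness
#print axioms witness_mul_of207
#print axioms restr129_mul_inv_of_cond179_local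

end Literature.MathematicalPhysics.QuantumFieldTheory.Balaban1983to89.B8Restr129InversionLocal

end
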